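import Summits.BirchSwinnertonDyer.BirchSwinnertonDyer.Theorems.ErratumRoadFiveSelmerDefectAssemblySigma
import HarnessLib

/-!
# Route `ErratumRoadFive` (K2, `p ≥ 5`), crux (T) `Rest3TorsionBranchAtFive` (item
# stmt-BirchSwinnertonDyer-19702): the `g_m`-SIDE LOCAL INPUT OF THEOREM T♭ FROM THE `f`-SIDE — memo
# §31.2 (g) in the kernel: through the congruence `M_{g_m}[a^m] ≅ M_f[a^m]` and the exponent descent, the
# local invariants of `M_{g_{m+j+1}}` are killed by `a^j`, finite, of order `≤ #M_f^{Γ_𝔭}`, uniformly; so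
# T♭'s Selmer-level kernel form needs local data for `E` ONLY ((L1), g14) — referee's R31-3 in the kernel

Cell `bsd-stepL` (run/shared/lean/pub/bsd-stepL/), seat `bsd-stepL-bdp` (prover g15, 2026-08-27), memo
`HOME/proof/PROOF-BDP.md` §31.2 (g), §33.9; `--supports stmt-BirchSwinnertonDyer-19702 --as helper`.

* `nonempty_torsionIso_of_dvd` — an isomorphism of the `r'`-torsion representations restricts to one of
  the `r`-torsion representations for `r ∣ r'` (re-indexing (b): `M_{g_{m+j+1}}[a^m] ≅ M_f[a^m]`).
* `smul_pow_eq_zero_of_mem_invariants_of_iso` / `finite_invariants_of_iso` / `natCard_invariants_le_of_iso`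
  — §31.2 (g): if `M_g` is `a`-primary, `M_g[a^m] ≅ M_f[a^m]` equivariantly, and `M_f^{Γ_v}` is killed by
  `a^j` with `j < m`, then `M_g^{Γ_v}` is killed by `a^j`, embeds into `M_f^{Γ_v}`, hence is finite of
  order `≤ #M_f^{Γ_v}` («a `ϖ`-primary module whose `ϖ^m`-torsion has exponent `ϖ^j`, `j < m`, equals
  its `ϖ^m`-torsion» — here with the congruence built in).
* `charIdeal_le_of_selmer_congruences_fLocal_printed` — THEOREM T♭ at the Selmer level (Σ-inserted, `μ`
  input in printed shape, `SelmerDefectAssemblySigma.…_printed`) with the `g`-side local hypotheses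
  (`hkillg`, `hB`, finiteness) REPLACED by the `f`-side ones (`hkillf`, `hBf`, `[Finite M_f^{Γ_𝔭}]`) and
  `a`-primarity of the `M_{g_m}`, via the re-indexed family `m ↦ g_{m+j+1}`.

HONEST FRAMING: theorems only (no definition, no named fact, no `sorry`); PURE ALGEBRA on abstract Selmer
data; objects (`M_E`, `M_{g_m}`, Shapiro, (a)(b)(c), FW21 4.41, Lemma 2.2, [Hsi14]) are NOT constructed or
asserted. Nothing is booked; no census word, tier or label moves (T7).
References: [Castella2018Erratum] Lemma 2.1, proof of Thm. 1.1 (p. 4); memo PROOF-BDP §31.2 (E)(g), §33.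
-/

set_option autoImplicit false
-- the Theorems namespace of this sub repeats the summit name by design (D-0017 nested layout)
set_option linter.dupNamespace false

noncomputable section

open CategoryTheory CharacterModule Literature.NumberTheory.GaloisRepresentations
  Literature.RingTheory.FittingIdeal Literature.NumberTheory.EllipticCurves
  Literature.NumberTheory.EllipticCurves.Module
  Summit.BirchSwinnertonDyer.Rank1Residual.X11b.TorsionControl
  Summit.BirchSwinnertonDyer.Rank1Residual.X11b
  Summit.BirchSwinnertonDyer.BirchSwinnertonDyer.Theorems.SelmerDefectAssemblySigma
open scoped ContRepresentation

namespace Summit.BirchSwinnertonDyer.BirchSwinnertonDyer.Theorems.LocalInvariantsTransfer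

universe u

/-! ### §1 Restricting an isomorphism of `r'`-torsion representations to the `r`-torsion (`r ∣ r'`) -/

section Restrict

variable {A : Type*} [CommRing A] [TopologicalSpace A]
variable {Γ : Type u} [Group Γ] [TopologicalSpace Γ]
variable {M₁ : Type u} [AddCommGroup M₁] [Module A M₁] [TopologicalSpace M₁] [DiscreteTopology M₁]
  [ContinuousSMul A M₁]
variable {M₂ : Type u} [AddCommGroup M₂] [Module A M₂] [TopologicalSpace M₂] [DiscreteTopology M₂]
  [ContinuousSMul A M₂]

/-- The underlying map of an isomorphism of discrete representations is a left inverse of the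
underlying map of its inverse. [folklore] -/
theorem iso_inv_hom_apply {ρ₁ : ContinuousRep Γ A M₁} {ρ₂ : ContinuousRep Γ A M₂}
    (e : ρ₁.toTopRep ≅ ρ₂.toTopRep) (x : M₁) : e.inv.hom (e.hom.hom x) = x := by
  have h := congrArg (fun f => TopRep.Hom.hom f x) e.hom_inv_id
  simp only [TopRep.hom_comp, TopRep.hom_id] at h
  exact h

/-- The same for the other composite. [folklore] -/
theorem iso_hom_inv_apply {ρ₁ : ContinuousRep Γ A M₁} {ρ₂ : ContinuousRep Γ A M₂}
    (e : ρ₁.toTopRep ≅ ρ₂.toTopRep) (y : M₂) : e.hom.hom (e.inv.hom y) = y := by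
  have h := congrArg (fun f => TopRep.Hom.hom f y) e.inv_hom_id
  simp only [TopRep.hom_comp, TopRep.hom_id] at h
  exact h

/-- Equivariance of the underlying map of a morphism of the attached topological representations, in
terms of `ρ₁`, `ρ₂`. [folklore] -/
theorem hom_apply_apply {ρ₁ : ContinuousRep Γ A M₁} {ρ₂ : ContinuousRep Γ A M₂}
    (f : ρ₁.toTopRep ⟶ ρ₂.toTopRep) (g : Γ) (x : M₁) : f.hom (ρ₁ g x) = ρ₂ g (f.hom x) :=
  TopRep.hom_comm_apply f g x

/-- **(b) RE-INDEXED: an isomorphism `M₁[r'] ≅ M₂[r']` of discrete `Γ`-modules restricts to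
`M₁[r] ≅ M₂[r]` for `r ∣ r'`** (`M[r] ⊆ M[r']` is `Γ`-stable and the isomorphism is `A`-linear). Used
with `r = a^m ∣ a^{m+j} = r'`: the erratum's (b) at level `m + j` gives (b) at level `m` for the SAME
form `g_{m+j}`. [cite: Castella2018Erratum, proof of Thm. 1.1, (b) (p. 4)] -/
theorem nonempty_torsionIso_of_dvd (ρ₁ : ContinuousRep Γ A M₁) (ρ₂ : ContinuousRep Γ A M₂)
    {r r' : A} (hrr : r ∣ r')
    (e : (torsionRep ρ₁ r').toTopRep ≅ (torsionRep ρ₂ r').toTopRep) :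
    Nonempty ((torsionRep ρ₁ r).toTopRep ≅ (torsionRep ρ₂ r).toTopRep) := by
  have hle₁ : Submodule.torsionBy A M₁ r ≤ Submodule.torsionBy A M₁ r' :=
    Submodule.torsionBy_le_torsionBy_of_dvd r r' hrr
  have hle₂ : Submodule.torsionBy A M₂ r ≤ Submodule.torsionBy A M₂ r' :=
    Submodule.torsionBy_le_torsionBy_of_dvd r r' hrr
  -- the forward map `M₁[r] → M₂[r]`
  have hF : ∀ x : Submodule.torsionBy A M₁ r,
      ((e.hom.hom (Submodule.inclusion hle₁ x) : Submodule.torsionBy A M₂ r') : M₂) ∈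
        Submodule.torsionBy A M₂ r := by
    intro x
    rw [Submodule.mem_torsionBy_iff, ← Submodule.coe_smul, ← map_smul]
    have hx : r • Submodule.inclusion hle₁ x = 0 := by
      apply Subtype.ext
      rw [Submodule.coe_smul, Submodule.coe_inclusion, Submodule.coe_zero]
      exact (Submodule.mem_torsionBy_iff r (x : M₁)).1 x.2
    rw [hx, map_zero, Submodule.coe_zero]
  have hG : ∀ y : Submodule.torsionBy A M₂ r,
      ((e.inv.hom (Submodule.inclusion hle₂ y) : Submodule.torsionBy A M₁ r') : M₁) ∈
        Submodule.torsionBy A M₁ r := by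
    intro y
    rw [Submodule.mem_torsionBy_iff, ← Submodule.coe_smul, ← map_smul]
    have hy : r • Submodule.inclusion hle₂ y = 0 := by
      apply Subtype.ext
      rw [Submodule.coe_smul, Submodule.coe_inclusion, Submodule.coe_zero]
      exact (Submodule.mem_torsionBy_iff r (y : M₂)).1 y.2
    rw [hy, map_zero, Submodule.coe_zero]
  let F : Submodule.torsionBy A M₁ r →ₗ[A] Submodule.torsionBy A M₂ r :=
    { toFun := fun x => ⟨_, hF x⟩
      map_add' := fun x x' => by
        apply Subtype.ext
        simp only [map_add, Submodule.coe_add]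
      map_smul' := fun c x => by
        apply Subtype.ext
        simp only [map_smul, Submodule.coe_smul, RingHom.id_apply] }
  let G : Submodule.torsionBy A M₂ r →ₗ[A] Submodule.torsionBy A M₁ r :=
    { toFun := fun y => ⟨_, hG y⟩
      map_add' := fun y y' => by
        apply Subtype.ext
        simp only [map_add, Submodule.coe_add]
      map_smul' := fun c y => by
        apply Subtype.ext
        simp only [map_smul, Submodule.coe_smul, RingHom.id_apply] }
  have hGF : ∀ x, G (F x) = x := by
    intro x
    apply Subtype.ext
    change ((e.inv.hom (Submodule.inclusion hle₂ ⟨_, hF x⟩) : Submodule.torsionBy A M₁ r') : M₁) = x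
    have h1 : Submodule.inclusion hle₂ ⟨_, hF x⟩ = e.hom.hom (Submodule.inclusion hle₁ x) :=
      Subtype.ext rfl
    rw [h1, iso_inv_hom_apply]
    rfl
  have hFG : ∀ y, F (G y) = y := by
    intro y
    apply Subtype.ext
    change ((e.hom.hom (Submodule.inclusion hle₁ ⟨_, hG y⟩) : Submodule.torsionBy A M₂ r') : M₂) = y
    have h1 : Submodule.inclusion hle₁ ⟨_, hG y⟩ = e.inv.hom (Submodule.inclusion hle₂ y) :=
      Subtype.ext rfl
    rw [h1, iso_hom_inv_apply]
    rfl
  let θ : Submodule.torsionBy A M₁ r ≃ₗ[A] Submodule.torsionBy A M₂ r :=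
    { F with
      invFun := G
      left_inv := hGF
      right_inv := hFG }
  refine ⟨isoOfLinearEquiv θ fun g x => ?_⟩
  apply Subtype.ext
  change ((e.hom.hom (Submodule.inclusion hle₁ (torsionRep ρ₁ r g x)) : Submodule.torsionBy A M₂ r') :
      M₂) = ((torsionRep ρ₂ r g ⟨_, hF x⟩ : Submodule.torsionBy A M₂ r) : M₂)
  have h1 : Submodule.inclusion hle₁ (torsionRep ρ₁ r g x) =
      torsionRep ρ₁ r' g (Submodule.inclusion hle₁ x) := Subtype.ext rfl
  rw [h1, hom_apply_apply e.hom g, torsionRep_apply_coe, torsionRep_apply_coe]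

end Restrict

/-! ### §2 Memo §31.2 (g): local invariants of `M_g` from those of `M_f` through the congruence -/

section Transfer

variable {A : Type*} [CommRing A] [TopologicalSpace A]
variable {Γ : Type u} [Group Γ] [TopologicalSpace Γ]
variable {H : Type*} [Group H] [TopologicalSpace H] (φ : H →ₜ* Γ)
variable {Mf : Type u} [AddCommGroup Mf] [Module A Mf] [TopologicalSpace Mf] [DiscreteTopology Mf]
  [ContinuousSMul A Mf]
variable {Mg : Type u} [AddCommGroup Mg] [Module A Mg] [TopologicalSpace Mg] [DiscreteTopology Mg]
  [ContinuousSMul A Mg]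
variable (ρf : ContinuousRep Γ A Mf) (ρg : ContinuousRep Γ A Mg) (a : A) {j m : ℕ}

/-- The image under `θ : M_g[a^m] ≅ M_f[a^m]` of an `H`-invariant `a^m`-torsion vector is `H`-invariant.
[folklore] -/
theorem coe_hom_mem_invariants (θ : (torsionRep ρg (a ^ m)).toTopRep ≅ (torsionRep ρf (a ^ m)).toTopRep)
    {w : Mg} (hw : w ∈ (ρg.restrict φ).toTopRep.ρ.invariants) (hwm : a ^ m • w = 0) :
    ((θ.hom.hom ⟨w, (Submodule.mem_torsionBy_iff _ _).2 hwm⟩ : Submodule.torsionBy A Mf (a ^ m)) : Mf)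
      ∈ (ρf.restrict φ).toTopRep.ρ.invariants := by
  intro h
  change ρf (φ h) _ = _
  have hfix : torsionRep ρg (a ^ m) (φ h) ⟨w, (Submodule.mem_torsionBy_iff _ _).2 hwm⟩ =
      ⟨w, (Submodule.mem_torsionBy_iff _ _).2 hwm⟩ := Subtype.ext (hw h)
  rw [← torsionRep_apply_coe ρf (a ^ m) (φ h), ← hom_apply_apply θ.hom (φ h), hfix]

/-- **The core step of (g)**: an `H`-invariant `w ∈ M_g` with `a^m • w = 0` is killed by `a^j` if
`M_f^{H}` is (through `θ`, injective). [cite: Castella2018Erratum, Lemma 2.1 (H⁰(K_𝔭, A_g[ϖ]) versus H⁰(K_𝔭, A_g))] -/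
theorem smul_pow_eq_zero_of_torsion_of_iso
    (θ : (torsionRep ρg (a ^ m)).toTopRep ≅ (torsionRep ρf (a ^ m)).toTopRep)
    (hkillf : ∀ v ∈ (ρf.restrict φ).toTopRep.ρ.invariants, a ^ j • v = 0)
    {w : Mg} (hw : w ∈ (ρg.restrict φ).toTopRep.ρ.invariants) (hwm : a ^ m • w = 0) :
    a ^ j • w = 0 := by
  set x : Submodule.torsionBy A Mg (a ^ m) := ⟨w, (Submodule.mem_torsionBy_iff _ _).2 hwm⟩ with hx
  have h1 : a ^ j • θ.hom.hom x = 0 := by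
    apply Subtype.ext
    rw [Submodule.coe_smul, Submodule.coe_zero]
    exact hkillf _ (coe_hom_mem_invariants φ ρf ρg a θ hw hwm)
  have h2 : a ^ j • x = 0 := by
    have := congrArg (fun y => θ.inv.hom y) h1
    rwa [← map_smul, iso_inv_hom_apply, map_zero] at this
  have := congrArg Subtype.val h2
  simpa [hx] using this

/-- **Memo §31.2 (g), exponent**: if `M_g` is `a`-primary, `M_g[a^m] ≅ M_f[a^m]` equivariantly, and
`M_f^{H}` is killed by `a^j` with `j < m`, then `M_g^{H}` is killed by `a^j` (strong induction on the
`a`-exponent of the vector: an exponent `n > m` drops to `n − m + j < n`). [cite: Castella2018Erratum, Lemma 2.1 (H⁰(K_𝔭, A_g[ϖ]) versus H⁰(K_𝔭, A_g))] -/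
theorem smul_pow_eq_zero_of_mem_invariants_of_iso (hjm : j < m)
    (θ : (torsionRep ρg (a ^ m)).toTopRep ≅ (torsionRep ρf (a ^ m)).toTopRep)
    (hprim : ∀ w : Mg, ∃ n : ℕ, a ^ n • w = 0)
    (hkillf : ∀ v ∈ (ρf.restrict φ).toTopRep.ρ.invariants, a ^ j • v = 0)
    {w : Mg} (hw : w ∈ (ρg.restrict φ).toTopRep.ρ.invariants) : a ^ j • w = 0 := by
  obtain ⟨n, hn⟩ := hprim w
  induction n using Nat.strong_induction_on generalizing w with
  | _ n ih =>
    by_cases hnm : n ≤ m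
    · refine smul_pow_eq_zero_of_torsion_of_iso φ ρf ρg a θ hkillf hw ?_
      rw [← Nat.sub_add_cancel hnm, pow_add, mul_smul, hn, smul_zero]
    · rw [not_le] at hnm
      -- `u := a^{n-m} • w` is invariant with `a^m • u = 0`, so `a^j • u = 0`, i.e. `a^{n-m+j} • w = 0`
      have hu : a ^ (n - m) • w ∈ (ρg.restrict φ).toTopRep.ρ.invariants := fun h => by
        change ρg (φ h) _ = _
        rw [map_smul]
        exact congrArg _ (hw h)
      have hum : a ^ m • (a ^ (n - m) • w) = 0 := by
        rw [smul_smul, ← pow_add, Nat.add_sub_cancel' hnm.le, hn]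
      have h1 : a ^ (n - m + j) • w = 0 := by
        rw [add_comm, pow_add, mul_smul]
        exact smul_pow_eq_zero_of_torsion_of_iso φ ρf ρg a θ hkillf hu hum
      exact ih (n - m + j) (by omega) hw h1

/-- **Memo §31.2 (g), finiteness and order**: under the same hypotheses `M_g^{H}` embeds into `M_f^{H}`
(`w ↦ θ(w)`), so it is finite with `#M_g^{H} ≤ #M_f^{H}`. [cite: Castella2018Erratum, Lemma 2.1 (H⁰(K_𝔭, A_g[ϖ]) versus H⁰(K_𝔭, A_g))] -/
theorem finite_and_natCard_invariants_le_of_iso (hjm : j < m)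
    (θ : (torsionRep ρg (a ^ m)).toTopRep ≅ (torsionRep ρf (a ^ m)).toTopRep)
    (hprim : ∀ w : Mg, ∃ n : ℕ, a ^ n • w = 0)
    (hkillf : ∀ v ∈ (ρf.restrict φ).toTopRep.ρ.invariants, a ^ j • v = 0)
    [Finite (ρf.restrict φ).toTopRep.ρ.invariants] :
    Finite (ρg.restrict φ).toTopRep.ρ.invariants ∧
      Nat.card (ρg.restrict φ).toTopRep.ρ.invariants ≤ Nat.card (ρf.restrict φ).toTopRep.ρ.invariants := by
  have hm : ∀ w : (ρg.restrict φ).toTopRep.ρ.invariants, a ^ m • (w : Mg) = 0 := fun w => by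
    have h := smul_pow_eq_zero_of_mem_invariants_of_iso φ ρf ρg a hjm θ hprim hkillf w.2
    rw [← Nat.sub_add_cancel hjm.le, pow_add, mul_smul, h, smul_zero]
  let ev : (ρg.restrict φ).toTopRep.ρ.invariants → (ρf.restrict φ).toTopRep.ρ.invariants := fun w =>
    ⟨_, coe_hom_mem_invariants φ ρf ρg a θ w.2 (hm w)⟩
  have hinj : Function.Injective fun x : Submodule.torsionBy A Mg (a ^ m) => θ.hom.hom x :=
    Function.LeftInverse.injective (g := fun y => θ.inv.hom y) (iso_inv_hom_apply θ)
  have hev : Function.Injective ev := by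
    intro w w' h
    have h1 := congrArg Subtype.val h
    have h2 := hinj (Subtype.ext h1 :
      θ.hom.hom ⟨(w : Mg), (Submodule.mem_torsionBy_iff _ _).2 (hm w)⟩ =
        θ.hom.hom ⟨(w' : Mg), (Submodule.mem_torsionBy_iff _ _).2 (hm w')⟩)
    have h3 := congrArg Subtype.val h2
    exact Subtype.ext h3
  exact ⟨Finite.of_injective ev hev, Nat.card_le_card_of_injective ev hev⟩

end Transfer

/-! ### §3 THEOREM T♭ at the Selmer level with LOCAL DATA FOR `f` ONLY -/

section Assembly

variable {𝒪 : Type} [CommRing 𝒪] [IsDomain 𝒪] [IsDiscreteValuationRing 𝒪]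
  [IsAdicComplete (IsLocalRing.maximalIdeal 𝒪) 𝒪] [TopologicalSpace (PowerSeries 𝒪)]
variable {Γ₀ : Type} [Group Γ₀] [TopologicalSpace Γ₀] [IsTopologicalGroup Γ₀]
variable {ι₀ : Type*} {Γw : ι₀ → Type} [∀ v, Group (Γw v)] [∀ v, TopologicalSpace (Γw v)]
  [∀ v, IsTopologicalGroup (Γw v)] (ψ : ∀ v, Γw v →ₜ* Γ₀)

/-- **THEOREM T♭ (erratum Thm. 1.1 WITHOUT (iv)), one-sided, Selmer level, Σ-inserted, `μ`-input in
printed shape, and LOCAL DATA FOR `f` ONLY.** As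
`SelmerDefectAssemblySigma.charIdeal_le_of_selmer_congruences_finite_localInvariants_printed` — whose
`g`-side local hypotheses (`M_{g_m}^{Γ_{v₀}}` finite of order `≤ B`, killed by `π^k`, all `m`) are here
DERIVED (memo §31.2 (g)) from: `M_f^{Γ_{v₀}}` finite of order `≤ B` and killed by `a^j` (for
`M_f = E[p^∞] ⊗ Λ^*`: (L1) + Shapiro, `BigRepLocalInvariants`), the `M_{g_m}` `a`-primary (discrete
`p`-primary modules), `a^j ∣ π^k`, and the congruences (b) `θ_m` themselves — applied to the RE-INDEXED
family `m ↦ g_{m+j+1}` ((b), (c), (2.5) at level `m + j + 1` imply them at level `m`). Conclusion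
**`Ch_Λ(X₀) ⊆ (L)`**. Pure algebra on abstract data; CONDITIONAL on nothing; books nothing.
[cite: Castella2018Erratum, proof of Thm. 1.1 (p. 4), read one-sidedly and without (iv)] -/
theorem charIdeal_le_of_selmer_congruences_fLocal_printed (v₀ : ι₀)
    (a : PowerSeries 𝒪) (ha : Ideal.span {a} ≤ (⊥ : Ideal (PowerSeries 𝒪)).jacobson)
    {Mf : Type} [AddCommGroup Mf] [Module (PowerSeries 𝒪) Mf] [TopologicalSpace Mf]
    [DiscreteTopology Mf] [ContinuousSMul (PowerSeries 𝒪) Mf] (ρf : ContinuousRep Γ₀ (PowerSeries 𝒪) Mf)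
    (hdivf : Function.Surjective fun x : Mf => a • x) (h0f : ρf.toTopRep.ρ.invariants = ⊥)
    (Mg : ℕ → Type) [∀ m, AddCommGroup (Mg m)] [∀ m, Module (PowerSeries 𝒪) (Mg m)]
    [∀ m, TopologicalSpace (Mg m)] [∀ m, DiscreteTopology (Mg m)]
    [∀ m, ContinuousSMul (PowerSeries 𝒪) (Mg m)] (ρg : ∀ m, ContinuousRep Γ₀ (PowerSeries 𝒪) (Mg m))
    (hdivg : ∀ m, Function.Surjective fun x : Mg m => a • x)
    (h0g : ∀ m, (ρg m).toTopRep.ρ.invariants = ⊥)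
    (hprim : ∀ m (w : Mg m), ∃ n : ℕ, a ^ n • w = 0)
    (θ : ∀ m, 1 ≤ m → ((torsionRep (ρg m) (a ^ m)).toTopRep ≅ (torsionRep ρf (a ^ m)).toTopRep))
    [Module.Finite (PowerSeries 𝒪) (CharacterModule (selmer ψ {v₀} ρf))]
    [∀ m, Module.Finite (PowerSeries 𝒪) (CharacterModule (selmer ψ {v₀} (ρg m)))]
    [Finite ((ρf.restrict (ψ v₀)).toTopRep).ρ.invariants]
    {M₀ : Type} [AddCommGroup M₀] [Module (PowerSeries 𝒪) M₀] [Module.Finite (PowerSeries 𝒪) M₀]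
    {ϖ : 𝒪} (hϖ : Prime ϖ) {L LS P : PowerSeries 𝒪} (hLS : LS = L * P) (hP : P ≠ 0)
    (j k B : ℕ) (hjk : a ^ j ∣ PowerSeries.C ϖ ^ k) (Lm : ℕ → PowerSeries 𝒪)
    (hkillf : ∀ w : Mf, w ∈ ((ρf.restrict (ψ v₀)).toTopRep).ρ.invariants → a ^ j • w = 0)
    (hBf : Nat.card ((ρf.restrict (ψ v₀)).toTopRep).ρ.invariants ≤ B)
    (hCh : ∀ m, 1 ≤ m → Module.IsTorsion (PowerSeries 𝒪) (CharacterModule (selmer ψ {v₀} (ρg m))) →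
      charIdeal (PowerSeries 𝒪) (CharacterModule (selmer ψ {v₀} (ρg m))) ≤ Ideal.span {Lm m})
    (hc : ∀ m, 1 ≤ m →
      Ideal.span {Lm m} ⊔ (Ideal.span {a}) ^ m = Ideal.span {LS} ⊔ (Ideal.span {a}) ^ m)
    (hTS : Module.IsTorsion (PowerSeries 𝒪) (CharacterModule (selmer ψ {v₀} ρf)))
    (hnfS : ∀ N' : Submodule (PowerSeries 𝒪) (CharacterModule (selmer ψ {v₀} ρf)),
      Module.length (PowerSeries 𝒪) N' ≠ ⊤ → N' = ⊥)
    (hT₀ : Module.IsTorsion (PowerSeries 𝒪) M₀)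
    (hnf₀ : ∀ N' : Submodule (PowerSeries 𝒪) M₀, Module.length (PowerSeries 𝒪) N' ≠ ⊤ → N' = ⊥)
    (hSig : charIdeal (PowerSeries 𝒪) M₀ * Ideal.span {P} ≤
      charIdeal (PowerSeries 𝒪) (CharacterModule (selmer ψ {v₀} ρf)))
    {Lm₀ C Cm u : PowerSeries 𝒪} {t : ℕ} {J : Ideal (PowerSeries 𝒪)}
    {ι : Type*} (S : Finset ι) (Q Qm : ι → Polynomial 𝒪) (z zm : ι → PowerSeries 𝒪)
    (hc₀ : Ideal.span {Lm₀ * Cm * ∏ i ∈ S, Polynomial.aeval (zm i) (Qm i)} ⊔ J =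
      Ideal.span {L * C * ∏ i ∈ S, Polynomial.aeval (z i) (Q i)} ⊔ J)
    (hJ : J ≤ Ideal.span {PowerSeries.C ϖ ^ (t + 1)})
    (hCm : Cm = PowerSeries.C ϖ ^ t * u) (hu : ¬ PowerSeries.C ϖ ∣ u) (hC : PowerSeries.C ϖ ^ t ∣ C)
    (hQ : ∀ i ∈ S, ¬ ϖ ∣ (Qm i).coeff 0)
    (hz : ∀ i ∈ S, PowerSeries.map (Ideal.Quotient.mk (Ideal.span {ϖ})) (zm i) ≠
      PowerSeries.C (PowerSeries.constantCoeff
        (PowerSeries.map (Ideal.Quotient.mk (Ideal.span {ϖ})) (zm i))))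
    (hLm₀ : ¬ PowerSeries.C ϖ ∣ Lm₀) :
    charIdeal (PowerSeries 𝒪) M₀ ≤ Ideal.span {L} := by
  -- the re-indexed family `m ↦ g_{m+j+1}` with (b) restricted from level `m + j + 1` to level `m`
  have hdvd : ∀ m : ℕ, a ^ m ∣ a ^ (m + j + 1) := fun m => pow_dvd_pow a (by omega)
  let θ' : ∀ m : ℕ, 1 ≤ m →
      ((torsionRep (ρg (m + j + 1)) (a ^ m)).toTopRep ≅ (torsionRep ρf (a ^ m)).toTopRep) :=
    fun m _ => (nonempty_torsionIso_of_dvd (ρg (m + j + 1)) ρf (hdvd m) (θ (m + j + 1) (by omega))).some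
  -- local data for `g_{m+j+1}` from the `f`-side (memo §31.2 (g))
  have hloc : ∀ m : ℕ, Finite (((ρg (m + j + 1)).restrict (ψ v₀)).toTopRep).ρ.invariants ∧
      Nat.card (((ρg (m + j + 1)).restrict (ψ v₀)).toTopRep).ρ.invariants ≤
        Nat.card ((ρf.restrict (ψ v₀)).toTopRep).ρ.invariants := fun m =>
    finite_and_natCard_invariants_le_of_iso (ψ v₀) ρf (ρg (m + j + 1)) a (j := j) (m := m + j + 1)
      (by omega) (θ (m + j + 1) (by omega)) (hprim (m + j + 1)) hkillf
  haveI : ∀ m, Finite (((ρg (m + j + 1)).restrict (ψ v₀)).toTopRep).ρ.invariants := fun m => (hloc m).1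
  refine charIdeal_le_of_selmer_congruences_finite_localInvariants_printed ψ v₀ a ha ρf hdivf h0f
    (fun m => Mg (m + j + 1)) (fun m => ρg (m + j + 1)) (fun m => hdivg (m + j + 1))
    (fun m => h0g (m + j + 1)) θ' hϖ hLS hP k B (fun m => Lm (m + j + 1)) (fun m w hw => ?_)
    (fun m => (hloc m).2.trans hBf) (fun m _ => hCh (m + j + 1) (by omega)) (fun m _ => ?_)
    hTS hnfS hT₀ hnf₀ hSig S Q Qm z zm hc₀ hJ hCm hu hC hQ hz hLm₀
  · -- `π^k • w = 0` from `a^j • w = 0` and `a^j ∣ π^k`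
    obtain ⟨s, hs⟩ := hjk
    have hj : a ^ j • w = 0 :=
      smul_pow_eq_zero_of_mem_invariants_of_iso (ψ v₀) ρf (ρg (m + j + 1)) a (j := j) (m := m + j + 1)
        (by omega) (θ (m + j + 1) (by omega)) (hprim (m + j + 1)) hkillf hw
    rw [hs, mul_comm, mul_smul, hj, smul_zero]
  · -- (c) at level `m + j + 1` implies (c) at level `m`
    have hle : (Ideal.span {a}) ^ (m + j + 1) ≤ (Ideal.span {a}) ^ m :=
      Ideal.pow_le_pow_right (by omega)
    have h := hc (m + j + 1) (by omega)
    calc Ideal.span {Lm (m + j + 1)} ⊔ Ideal.span {a} ^ m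
        = Ideal.span {Lm (m + j + 1)} ⊔ Ideal.span {a} ^ (m + j + 1) ⊔ Ideal.span {a} ^ m := by
          rw [sup_assoc, sup_eq_right.mpr hle]
      _ = Ideal.span {LS} ⊔ Ideal.span {a} ^ (m + j + 1) ⊔ Ideal.span {a} ^ m := by rw [h]
      _ = Ideal.span {LS} ⊔ Ideal.span {a} ^ m := by rw [sup_assoc, sup_eq_right.mpr hle]

end Assembly

end Summit.BirchSwinnertonDyer.BirchSwinnertonDyer.Theorems.LocalInvariantsTransfer

end
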